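import Mathlib
import Literature.NumberTheory.EllipticCurves.ComplexMultiplicationNotSemistable
import Literature.NumberTheory.EllipticCurves.RationalIsogenyFrobeniusCriterion
import HarnessLib
import Literature.NumberTheory.SerreUniformity.SplitCartanProofs

/-!
# ModSevenImageSplitCartanJLine

Topic `Literature/NumberTheory/EllipticCurves`. Named literature fact(s) relocated by the gate from `Summits/BirchSwinnertonDyer/BirchSwinnertonDyer/Theorems/ErratumRoadFiveNonSurjCornerSevenInstancesNotSurj.lean`
(accept-time relocation of `[cite]`d propositions written inline in a Summits proposal; human ruling 2026-08-15).
Sources: Zywina2015.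

* `Literature.NumberTheory.EllipticCurves.zywina2015_thm15_not_surjective_seven_of_j_eq_J2`
-/

namespace Literature.NumberTheory.EllipticCurves

open scoped Classical
open WeierstrassCurve Literature.NumberTheory.EllipticCurves

/-- **Zywina 2015, Theorem 1.5 (ℓ = 7), second item for `i = 2` (`G₂ = N_s(7)`), the «if» direction weakened to
non-surjectivity.** As printed (arXiv:1508.07660, §1.4 and Thm. 1.5): "Let `G₂` be the group `N_s(7)`. …
`J₂(t) = t(t+1)³(t²−5t+1)³(t²−5t+8)³(t⁴−5t³+8t²−7t+7)³/(t³−4t²+3t+1)⁷` … Theorem 1.5. Let `E` be a non-CM elliptic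
curve over `ℚ`. … • The group `ρ_{E,7}(Gal_ℚ)` is conjugate to a subgroup of `G_i` if and only if `j_E` is of the form
`J_i(t)` for some `t ∈ ℚ`." (`N_s(7)` has index `28` in `GL₂(𝔽₇)`, loc. cit.) Vendored SPECIAL CASE: for `W/ℚ` elliptic
and non-CM (`¬ W.HasCM`) and `t ∈ ℚ` with `t³−4t²+3t+1 ≠ 0` and
`j(W)·(t³−4t²+3t+1)⁷ = t(t+1)³(t²−5t+1)³(t²−5t+8)³(t⁴−5t³+8t²−7t+7)³` (i.e. `j(W) = J₂(t)`), the mod-`7`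
representation `ρ̄_{W,7} : Γ_ℚ → Aut(W[7])` is NOT surjective. Named fact (a `Prop`; nothing asserted); consumers take
it as a hypothesis. Size L (modular-curve computation of `X_{N_s(7)}` and its j-map).
-- TODO(general form): the printed statement is «conjugate to a subgroup of N_s(7)» and an «iff»; the tree has no
-- vocabulary yet for conjugacy classes of subgroups of `Aut(W[7]) ≅ GL₂(𝔽₇)`, so only non-surjectivity is recorded.
[cite: Zywina2015, Thm. 1.5 (second item, i = 2) and §1.4 (G₂ = N_s(7), J₂) (arXiv:1508.07660)]
[file NumberTheory/EllipticCurves/ModSevenImageSplitCartanJLine] -/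
def zywina2015_thm15_not_surjective_seven_of_j_eq_J2 : Prop :=
  ∀ (W : WeierstrassCurve ℚ) [W.IsElliptic], ¬ W.HasCM → ∀ t : ℚ, t ^ 3 - 4 * t ^ 2 + 3 * t + 1 ≠ 0 →
    W.j * (t ^ 3 - 4 * t ^ 2 + 3 * t + 1) ^ 7 =
      t * (t + 1) ^ 3 * (t ^ 2 - 5 * t + 1) ^ 3 * (t ^ 2 - 5 * t + 8) ^ 3 *
        (t ^ 4 - 5 * t ^ 3 + 8 * t ^ 2 - 7 * t + 7) ^ 3 →
    ¬ W.HasSurjectiveModNGaloisRep 7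

/-! ## §2 `¬ Surj E 7` at the three instances, and the corner hypotheses from `r_an = 1` alone -/

end Literature.NumberTheory.EllipticCurves

/-! ## Relocated from `Summits/BirchSwinnertonDyer/BirchSwinnertonDyer/Theorems/ErratumRoadFiveNonSurjCornerSevenJLine.lean` (gate, accept-time relocation of cited facts) — Zywina2015 -/

namespace Literature.NumberTheory.EllipticCurves

open scoped Classical NumberField
open IsDedekindDomain Field WeierstrassCurve
open WeierstrassCurve NumberField

/-- **Zywina 2015, Theorem 1.5 (`ℓ = 7`), second item for `i = 2` (`G₂ = N_s(7)`), the «only if» half.** As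
printed (arXiv:1508.07660, §1.4 and Thm. 1.5): «Let `G₂` be the group `N_s(7)`. …
`J₂(t) = t(t+1)³(t²−5t+1)³(t²−5t+8)³(t⁴−5t³+8t²−7t+7)³/(t³−4t²+3t+1)⁷` … Theorem 1.5. Let `E` be a non-CM
elliptic curve over `ℚ`. … • The group `ρ_{E,7}(Gal_ℚ)` is conjugate to a subgroup of `G_i` if and only if
`j_E` is of the form `J_i(t)` for some `t ∈ ℚ`.» Vendored SPECIAL CASE (`i = 2`, direction ⟹): for `W/ℚ`
elliptic and non-CM whose mod-`7` image is conjugate into `N_s(7)` — the tree's explicit-basis predicate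
`SerreUniformity.HasSplitCartanNormalizerModPImage W 7` (every `σ ∈ Γ_ℚ` acts by an invertible diagonal or
antidiagonal matrix in some basis of `E[7]`; all split Cartan normalisers are conjugate) — there is `t ∈ ℚ`
with `t³−4t²+3t+1 ≠ 0` (automatic: the cubic has no rational root) and
`j(W)·(t³−4t²+3t+1)⁷ = t(t+1)³(t²−5t+1)³(t²−5t+8)³(t⁴−5t³+8t²−7t+7)³`, i.e. `j(W) = J₂(t)`. Companion of the
tree's «if»-half fact `zywina2015_thm15_not_surjective_seven_of_j_eq_J2` (same `J₂`). Named fact (a `Prop`;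
nothing asserted); consumers take it as a hypothesis. Size L (the modular curve `X_{N_s(7)} ≅ ℙ¹_ℚ` and
its j-map). `-- TODO(general form): the other groups G_i, H_{i,j} of Thm. 1.5 and the curves 𝓔_{i,t}.`
[cite: Zywina2015, Thm. 1.5 (second item, i = 2) and §1.4 (G₂ = N_s(7), J₂) (arXiv:1508.07660 pp. 5–6)]
[file NumberTheory/EllipticCurves/ModSevenImageSplitCartanJLine] -/
def zywina2015_thm15_exists_j_eq_J2_of_splitCartanNormalizer_seven : Prop :=
  ∀ (W : WeierstrassCurve ℚ) [W.IsElliptic], ¬ W.HasCM →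
    Literature.NumberTheory.SerreUniformity.HasSplitCartanNormalizerModPImage W 7 →
    ∃ t : ℚ, t ^ 3 - 4 * t ^ 2 + 3 * t + 1 ≠ 0 ∧
      W.j * (t ^ 3 - 4 * t ^ 2 + 3 * t + 1) ^ 7 =
        t * (t + 1) ^ 3 * (t ^ 2 - 5 * t + 1) ^ 3 * (t ^ 2 - 5 * t + 8) ^ 3 *
          (t ^ 4 - 5 * t ^ 3 + 8 * t ^ 2 - 7 * t + 7) ^ 3

end Literature.NumberTheory.EllipticCurves
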